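import Literature.AlgebraicGeometry.PlaneCurves.HessePencilCharacteristicThreeWeierstrass
import Literature.AlgebraicGeometry.PlaneCurves.PlaneCubicJInvariant
import Literature.AlgebraicGeometry.PlaneCurves.WeierstrassNormalForm
import HarnessLib

/-!
# The Hesse canonical form in characteristic `3`: ordinary curves only, members pairwise inequivalent (Artebani–Dolgachev, Remark 2.1)

Topic `Literature/AlgebraicGeometry/PlaneCurves`, namespace `Literature.AlgebraicGeometry.PlaneCurves`.
Lane `lit-hodgefound`, seat `lit-hodgefound-p37`, row g21-#8; the characteristic-`3` companion of
`HesseCanonicalForm` (g17-#7: Lemma 1 for `3 ≠ 0` by the `j`-invariant), built on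
`HessePencilCharacteristicThreeWeierstrass` (g21-#3: for `3 = 0`, `t ≠ 0`, `E_t ∘ M_t = −W₃[t]`,
`j(W₃[t]) = −t³`) and `PlaneCubicJInvariant` (g17-#2: two elliptic Weierstrass cubics over a
separably closed field are projectively equivalent iff their `j`-invariants agree; projective
equivalence preserves `j` over any field).  Everything here is PROVED; no definition, no named fact.

Source — M. Artebani, I. Dolgachev, *The Hesse pencil of plane cubic curves*, Enseign. Math. (2) 55
(2009), §2, Remark 2.1 [`paper:arxiv-math_0611590` p0005 L60], VERBATIM: "The proof of the existence
of a Hesse equation for an elliptic curve `E` over a field of characteristic 3 goes through if we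
assume that `E` is an ordinary elliptic curve with rational 3-torsion points.  We find equation (4) and
check that it defines a nonsingular curve only if `abc ≠ 0`. […] to transform the equation to the
Hesse form `xyu + d(u + x + y)³ = xyu + d(u³ + x³ + y³) = 0`."  And Lemma 1 (p0004 L48): "Any smooth
plane cubic is projectively equivalent to a member of the Hesse pencil".

## The road taken (by the `j`-invariant, as in the tree's `HesseCanonicalForm`)

In characteristic `3` an elliptic curve is ordinary iff `j ≠ 0` (the only supersingular invariant is
`j = 0 = 1728`); the hypothesis is carried here as `j(W) ≠ 0`, and over an algebraically closed field
the rationality of the `3`-torsion is automatic.  (1) `exists_charThree_weierstrass_j_eq`: every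
`a ≠ 0` is `j(W₃[t]) = −t³` for some `t ≠ 0` (a cube root of `−a`, `K = K̄`).  (2)
**`weierstrass_exists_bind₁_hesseE_eq_smul_of_three_eq_zero`** — Remark 2.1: every elliptic
Weierstrass cubic `W` with `j(W) ≠ 0` over `K = K̄`, `3 = 0`, is projectively equivalent to a
nonsingular member `E_t`: `E_t ∘ M = c·W`.  (3) `weierstrass_j_eq_of_bind₁_hesseE` (any field with
`3 = 0`): conversely `E_t ∘ M = c·W` forces `j(W) = −t³ ≠ 0` — no supersingular curve has a Hesse
form in characteristic `3` (`hesseE_not_model_of_j_eq_zero`).  (4)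
**`hesseE_exists_bind₁_eq_smul_iff_of_three_eq_zero`** (any field with `3 = 0`): two nonsingular
members `E_s`, `E_t` are projectively equivalent iff `s = t` — since `j = −t³` and cubing is injective
in characteristic `3`, distinct nonsingular members are pairwise non-isomorphic (contrast `3 ≠ 0`,
where `H_μ ≅ H_ν` iff `μ³(μ³+8)³/(μ³−1)³ = ν³(ν³+8)³/(ν³−1)³`, twelve `μ` to a class in general).

## References
* [ArtebaniDolgachev2009] M. Artebani, I. Dolgachev, *The Hesse pencil of plane cubic curves*,
  Enseign. Math. (2) 55 (2009) 235–273, §2, Remark 2.1 and Lemma 1.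
* [Knapp1992] A. W. Knapp, *Elliptic Curves*, Princeton 1992, §II.2 (`F^Φ = F ∘ Φ⁻¹`).
-/

set_option autoImplicit false

open MvPolynomial Matrix
open Literature.AlgebraicGeometry.HyperbolicPolynomials

namespace Literature.AlgebraicGeometry.PlaneCurves

universe u

/-- The member `E_t = X³ + Y³ + Z³ + t·XYZ` (local notation, no definition). -/
local notation3 "𝐄[" t "]" =>
  (X 0 ^ 3 + X 1 ^ 3 + X 2 ^ 3 + C t * (X 0 * X 1 * X 2) : MvPolynomial (Fin 3) _)

/-- `M_t = [[0, t⁻¹, 0], [1, −t⁻¹, 0], [0, 0, t]]` (g21-#3; local notation). -/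
local notation3 "𝐌[" t "]" =>
  (Matrix.of ![![(0 : _), t⁻¹, 0], ![1, -t⁻¹, 0], ![0, 0, t]] : Matrix (Fin 3) (Fin 3) _)

/-- `W₃[t] = ⟨−t, 0, 0, 0, t³⟩` (g21-#3; local notation). -/
local notation3 "𝐖₃[" t "]" =>
  ({ a₁ := -t, a₂ := 0, a₃ := 0, a₄ := 0, a₆ := t ^ 3 } : WeierstrassCurve _)

section CharThreeCanonicalForm

variable {K : Type u} [Field K]

/-- Undoing a substitution: `(F ∘ M) ∘ M⁻¹ = F` (`det M ≠ 0`). [folklore] -/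
private theorem bind₁_inv_bind₁ {M : Matrix (Fin 3) (Fin 3) K} (hM : M.det ≠ 0)
    (P : MvPolynomial (Fin 3) K) :
    bind₁ M⁻¹.toMvPolynomial (bind₁ M.toMvPolynomial P) = P := by
  rw [← bind₁_toMvPolynomial_mul, Matrix.mul_nonsing_inv M (isUnit_iff_ne_zero.2 hM),
    Matrix.toMvPolynomial_one, bind₁_X_left, AlgHom.id_apply]

/-- `E_t = −(W₃[t] ∘ M_t⁻¹)`: the model of g21-#3 read backwards. [cite: ArtebaniDolgachev2009, §2,
Remark 2.1] -/
theorem hesseE_eq_neg_bind₁_inv (h3 : (3 : K) = 0) {t : K} (ht : t ≠ 0) :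
    (𝐄[t] : MvPolynomial (Fin 3) K) =
      -bind₁ (𝐌[t] : Matrix (Fin 3) (Fin 3) K)⁻¹.toMvPolynomial
        (𝐖₃[t] : WeierstrassCurve K).toProjective.polynomial := by
  have hM : (𝐌[t] : Matrix (Fin 3) (Fin 3) K).det ≠ 0 := by rw [charThree_matrix_det ht]; norm_num
  have h := congrArg (bind₁ (𝐌[t] : Matrix (Fin 3) (Fin 3) K)⁻¹.toMvPolynomial)
    (hesseE_bind₁_charThree h3 ht)
  rw [bind₁_inv_bind₁ hM, map_neg] at h
  exact h

/-! ## §1 The `j`-map of the pencil in characteristic `3` is onto `K ∖ {0}` -/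

/-- Every `a ≠ 0` of an algebraically closed field with `3 = 0` is `j(W₃[t]) = −t³` for some `t ≠ 0`
(a cube root of `−a`). [cite: ArtebaniDolgachev2009, §2 (the `j`-map of the pencil), Remark 2.1] -/
theorem exists_charThree_weierstrass_j_eq [IsAlgClosed K] (h3 : (3 : K) = 0) {a : K} (ha : a ≠ 0) :
    ∃ (t : K) (ht : t ≠ 0),
      (haveI := (charThree_weierstrass_isElliptic_iff h3 t).2 ht; (𝐖₃[t] : WeierstrassCurve K).j) = a := by
  obtain ⟨t, ht3⟩ := IsAlgClosed.exists_pow_nat_eq (-a) (by norm_num : 0 < 3)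
  have ht : t ≠ 0 := by
    rintro rfl
    rw [zero_pow three_ne_zero] at ht3
    exact ha (neg_eq_zero.1 ht3.symm)
  refine ⟨t, ht, ?_⟩
  rw [charThree_weierstrass_j h3 ht, ht3, neg_neg]

/-! ## §2 Remark 2.1: every ordinary elliptic curve has a Hesse form -/

/-- **Artebani–Dolgachev, Remark 2.1: "the existence of a Hesse equation for an elliptic curve `E`
over a field of characteristic 3 goes through if we assume that `E` is an ordinary elliptic curve".**
Over an algebraically closed field with `3 = 0`, every elliptic Weierstrass cubic `W` with `j(W) ≠ 0`
is projectively equivalent to a nonsingular member of the Hesse pencil: `E_t ∘ M = c·W` with `t ≠ 0`,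
`det M ≠ 0`, `c ≠ 0` (by the `j`-invariant: `j(W₃[t]) = j(W)` for a cube root `t` of `−j(W)`,
`PlaneCubicJInvariant`, composed with `E_t ∘ M_t = −W₃[t]`). [cite: ArtebaniDolgachev2009, §2,
Remark 2.1; Lemma 1] -/
theorem weierstrass_exists_bind₁_hesseE_eq_smul_of_three_eq_zero [IsAlgClosed K] (h3 : (3 : K) = 0)
    (W : WeierstrassCurve K) [W.IsElliptic] (hj : W.j ≠ 0) :
    ∃ (t : K) (M : Matrix (Fin 3) (Fin 3) K) (c : K), t ≠ 0 ∧ M.det ≠ 0 ∧ c ≠ 0 ∧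
      bind₁ M.toMvPolynomial 𝐄[t] = c • W.toProjective.polynomial := by
  obtain ⟨t, ht, hjt⟩ := exists_charThree_weierstrass_j_eq h3 hj
  haveI := (charThree_weierstrass_isElliptic_iff h3 t).2 ht
  obtain ⟨M₁, c₁, hM₁, hc₁, h₁⟩ :=
    (weierstrass_exists_bind₁_eq_smul_iff_j_eq (W := (𝐖₃[t] : WeierstrassCurve K)) (W' := W)).2 hjt
  refine ⟨t, (𝐌[t] : Matrix (Fin 3) (Fin 3) K) * M₁, -c₁, ht, ?_, neg_ne_zero.2 hc₁, ?_⟩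
  · rw [Matrix.det_mul, charThree_matrix_det ht]
    exact mul_ne_zero (by norm_num) hM₁
  · rw [bind₁_toMvPolynomial_mul, hesseE_bind₁_charThree h3 ht, map_neg, h₁, neg_smul]

/-! ## §3 No supersingular curve has a Hesse form; the parameter is determined -/

/-- **A Hesse form determines `j = −t³`**: over any field with `3 = 0`, if `E_t ∘ M = c·W` (`t ≠ 0`,
`det M ≠ 0`, `c ≠ 0`, `W` elliptic) then `j(W) = −t³`. [cite: ArtebaniDolgachev2009, §2, Remark 2.1
(ordinary curves), and the `j`-map of the pencil] -/
theorem weierstrass_j_eq_of_bind₁_hesseE (h3 : (3 : K) = 0) {t : K} (ht : t ≠ 0)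
    {W : WeierstrassCurve K} [W.IsElliptic] {M : Matrix (Fin 3) (Fin 3) K} (hM : M.det ≠ 0) {c : K}
    (hc : c ≠ 0) (h : bind₁ M.toMvPolynomial 𝐄[t] = c • W.toProjective.polynomial) :
    W.j = -t ^ 3 := by
  haveI := (charThree_weierstrass_isElliptic_iff h3 t).2 ht
  have hMt : (𝐌[t] : Matrix (Fin 3) (Fin 3) K).det ≠ 0 := by rw [charThree_matrix_det ht]; norm_num
  -- `W₃[t] ∘ (M_t⁻¹ M) = −c · W`
  have key : bind₁ ((𝐌[t] : Matrix (Fin 3) (Fin 3) K)⁻¹ * M).toMvPolynomial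
      (𝐖₃[t] : WeierstrassCurve K).toProjective.polynomial = (-c) • W.toProjective.polynomial := by
    rw [bind₁_toMvPolynomial_mul]
    have e : bind₁ (𝐌[t] : Matrix (Fin 3) (Fin 3) K)⁻¹.toMvPolynomial
        (𝐖₃[t] : WeierstrassCurve K).toProjective.polynomial = -(𝐄[t] : MvPolynomial (Fin 3) K) := by
      rw [hesseE_eq_neg_bind₁_inv h3 ht, neg_neg]
    rw [e, map_neg, h, neg_smul]
  have hdet : ((𝐌[t] : Matrix (Fin 3) (Fin 3) K)⁻¹ * M).det ≠ 0 := by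
    rw [Matrix.det_mul]
    exact mul_ne_zero
      (Matrix.isUnit_nonsing_inv_det _ (isUnit_iff_ne_zero.2 hMt)).ne_zero hM
  rw [← weierstrass_j_eq_of_bind₁_eq_smul hdet (neg_ne_zero.2 hc) key, charThree_weierstrass_j h3 ht]

/-- **No supersingular curve (`j = 0` in characteristic `3`) has a Hesse form**: if `j(W) = 0` then
`E_t ∘ M ≠ c·W` for all `t ≠ 0`, invertible `M`, `c ≠ 0`. [cite: ArtebaniDolgachev2009, §2,
Remark 2.1 ("if we assume that `E` is an ordinary elliptic curve")] -/
theorem hesseE_not_model_of_j_eq_zero (h3 : (3 : K) = 0) {W : WeierstrassCurve K} [W.IsElliptic]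
    (hj : W.j = 0) {t : K} (ht : t ≠ 0) {M : Matrix (Fin 3) (Fin 3) K} (hM : M.det ≠ 0) {c : K}
    (hc : c ≠ 0) : bind₁ M.toMvPolynomial 𝐄[t] ≠ c • W.toProjective.polynomial := by
  intro h
  have hj' := weierstrass_j_eq_of_bind₁_hesseE h3 ht hM hc h
  rw [hj] at hj'
  exact ht ((pow_eq_zero_iff three_ne_zero).1 (neg_eq_zero.1 hj'.symm))

/-- **Distinct nonsingular members are not projectively equivalent in characteristic `3`**: over any
field with `3 = 0`, for `s, t ≠ 0`: `E_s ∘ M = c·E_t` for some invertible `M`, `c ≠ 0` iff `s = t`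
(`j(W₃[s]) = j(W₃[t])` gives `s³ = t³`, i.e. `(s − t)³ = 0`). [cite: ArtebaniDolgachev2009, §2 (the
`j`-map "distinguishes the projective equivalence classes of cubic curves"), Remark 2.1] -/
theorem hesseE_exists_bind₁_eq_smul_iff_of_three_eq_zero (h3 : (3 : K) = 0) {s t : K} (hs : s ≠ 0)
    (ht : t ≠ 0) :
    (∃ (M : Matrix (Fin 3) (Fin 3) K) (c : K), M.det ≠ 0 ∧ c ≠ 0 ∧
      bind₁ M.toMvPolynomial 𝐄[s] = c • (𝐄[t] : MvPolynomial (Fin 3) K)) ↔ s = t := by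
  constructor
  · rintro ⟨M, c, hM, hc, h⟩
    haveI := (charThree_weierstrass_isElliptic_iff h3 t).2 ht
    have hMt : (𝐌[t] : Matrix (Fin 3) (Fin 3) K).det ≠ 0 := by rw [charThree_matrix_det ht]; norm_num
    -- `E_s ∘ (M M_t) = −c · W₃[t]`, so `j(W₃[t]) = −s³`
    have key : bind₁ (M * (𝐌[t] : Matrix (Fin 3) (Fin 3) K)).toMvPolynomial 𝐄[s] =
        (-c) • (𝐖₃[t] : WeierstrassCurve K).toProjective.polynomial := by
      rw [bind₁_toMvPolynomial_mul, h, map_smul, hesseE_bind₁_charThree h3 ht, smul_neg, neg_smul]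
    have hdet : (M * (𝐌[t] : Matrix (Fin 3) (Fin 3) K)).det ≠ 0 := by
      rw [Matrix.det_mul]; exact mul_ne_zero hM hMt
    have hj := weierstrass_j_eq_of_bind₁_hesseE h3 hs hdet (neg_ne_zero.2 hc) key
    rw [charThree_weierstrass_j h3 ht] at hj
    have hcube : (s - t) ^ 3 = 0 := by linear_combination (s * t ^ 2 - s ^ 2 * t) * h3 + hj
    linear_combination (pow_eq_zero_iff three_ne_zero).1 hcube
  · rintro rfl
    refine ⟨1, 1, by simp, one_ne_zero, ?_⟩
    rw [Matrix.toMvPolynomial_one, bind₁_X_left, AlgHom.id_apply, one_smul]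

end CharThreeCanonicalForm

end Literature.AlgebraicGeometry.PlaneCurves
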